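import Mathlib
import HarnessLib
import Summits.HubbardSuperconductivity.HubbardSuperconductivity.Theorems.KLProgrammeKLRegimeEngineScaleZeroE4PackageParts

/-!
# K3 ENGINE child (`KLRegimeEngineV16`, stmt-HubbardSuperconductivity-20236), stub `stub_engine_scale0`, conjunct (E4)₀
# `EngineFirstMoments … 0`: the PACKAGING from the landed reduction `firstMoment_zero_le_of_torusSums`, modulo the multiplier SPACE moment
# `T_X` by name and two smallness conditions

Cell `gate-hubbard-kl`, seat p4 (g9).  k3c2-p1's reduction (`…ScaleZeroE4TorusSums.firstMoment_zero_le_of_torusSums`, p501478) gives the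
scale-`0` first moment from four numbers: the weighted covariance torus sum `A_w` (enters the smallness `θ_w` only), the replica-Gram
constant `κ₀ = √(2(7+6047))` (`isGramBoundedR_scaleZero_of_frameOK_sharp`), the weighted multiplier torus sum `T_w`, and `θ_w < 1`.  With the parts of
`…ScaleZeroE4PackageParts` (`A_w ≤ 4M·Ā/β`, `kK_w ≤ k̄K`, `θ_w ≤ 1/2`) and `T_w ≤ (M/β)·(2·klIsoT + C_T + X)` — plain part = the isotropic torus
bound at `m = 0` (`klAnisoFamily … 0 = klIsoFamily … 0` definitionally, `isoTorusBoundAt_klIsoT`), time part = any witness `C_T` of p4 g8's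
`exists_timeMomentConst_klAnisoFamily_zero`, space part = the HYPOTHESIS `T_X ≤ X·(M/β)` (k3c2-p1's M6 export, plugged by name when it lands):

* **`engineFirstMoments_zero_of_bounds`** — under the binders of `stub_engine_scale0` (`klEngU₀3`-keyed), a cutoff-profile bound `B` (orders `≤ 5`),
  majorants `Ā`, `k̄K`, the smallness `16e⁵·Ā·k̄K ≤ 1`, `64e⁹κ₀²·Ā·|U| ≤ 1` and `T_X ≤ X·(M/β)`:
  `EngineFirstMoments L M G P (klEngQ5 P R) β U μ K 0` for every `G` with `16e⁹·(2·klIsoT + C_T + X)⁴ ≤ G.cE4`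
  (`ε_x³·T_w(2T_w)³·κ₀⁻⁴e(2e²κ₀)⁴|U|β/N/(1−θ_w)² ≤ 16e⁹(2klIsoT + C_T + X)⁴·|U| ≤ G.cE4·|U| ≤ (G.cE4 + Q.cE4|U|)·Klam·|U|`).

HONEST NOTE (finding E4-THR, KL STATUS 2026-08-27 ≈10:50Z): `uvTimeMomentConst`, `A_X(B)` and `C_T` are CLOSED BUT NON-NUMERIC (`uvMixedConst` and
the order-`≤ 5` cutoff bounds are `Classical.choose` of compactness existentials), so the two smallness conditions are NOT consequences of the numeric
thresholds `klEngC₃3`/`klEngU₀3`; they are to be discharged by doors on the `∃c₃`/`∃U₀` slots (companion Defs file), not here.  Everything here is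
proved; no definitions, no named facts, no sorry.  Nothing asserts superconductivity.
-/

noncomputable section

namespace Summit.HubbardSuperconductivity.HubbardSuperconductivity.Theorems.EngineV8

set_option linter.dupNamespace false -- summit = problem name (single-conjunct summit), D-0017

open Real Finset Complex Literature.MathematicalPhysics.QuantumLattice Literature.Probability.LatticeModels
open Literature.MathematicalPhysics.QuantumLattice.GrassmannAlgebra
open Summit.HubbardSuperconductivity.HubbardSuperconductivity.Theorems.KLRegimeSplit
open Summit.HubbardSuperconductivity.HubbardSuperconductivity.Theorems.DispersionFlow
open Summit.HubbardSuperconductivity.HubbardSuperconductivity.Theorems.KLProgrammeLegKernels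
open Summit.HubbardSuperconductivity.HubbardSuperconductivity.Theorems.ScaleZeroDecay
open scoped ComplexConjugate

/-! ## §4–§5 The clause (E4)₀ under the binders of `stub_engine_scale0`, two smallness conditions and the `T_X` hypothesis -/

section Main

/-- **(E4)₀ from the landed chain, modulo the multiplier space moment `T_X` and two smallness conditions.**  Under the binders of
`stub_engine_scale0` (`klEngU₀3`-keyed), for a cutoff-profile bound `B` (orders `≤ 5`), a time-moment constant `C_T` of the scale-`0`
multipliers (any witness of p4 g8's `exists_timeMomentConst_klAnisoFamily_zero`), majorants `Ā ≥ klScaleZeroA0 + uvTimeMomentConst klE0 7 32 + 2·A_X`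
and `k̄K ≥ klKappaFrameC R·|U| + 2·(n_β+1)U²·6(…)`, the smallness `16e⁵·Ā·k̄K ≤ 1`, `64e⁹κ₀²·Ā·|U| ≤ 1`, and the space-moment bound
`T_X ≤ X·(M/β)` of the scale-`0` multiplier character sums: `EngineFirstMoments L M G P (klEngQ5 P R) β U μ K 0` for every well-formed `G` with
`16e⁹·(2·klIsoT + C_T + X)⁴ ≤ G.cE4`. -/
theorem engineFirstMoments_zero_of_bounds {C_T : ℝ} (hCT0 : 0 ≤ C_T)
    (hCT : ∀ (L M : ℕ) [NeZero L] [NeZero M] (R : RenConsts) (U : ℝ) (N : ℕ) (μ : ℝ) (K : TrigPolyC4v),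
      FrameOK R U N μ K → (∀ j, 0 ≤ R.Gfr j) → μ ∈ klWindowC → 16 / 15 * (R.Gfr 0 * |U|) ≤ 1 / 50 → (2 : ℝ) ^ 15 ≤ L →
      ∀ β : ℝ, klBetaMin ≤ β → β ≤ M → klE0 * β ≤ Real.pi * (2 * M - 13) →
      ∀ (ω : Fin (sectorCount 0)) (c : Fin 2),
        1 / (|β| * (L : ℝ) ^ 2) *
            ∑ dw : TorusSite 1 (2 * (2 * M)) × TorusSite 2 L,
              (β / (2 * (2 * M) : ℕ) * cyclicDist (2 * (2 * M)) (dw.1 0) 0) *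
                ‖∑ k : FreqMomentum L M, klAnisoFamily L M β μ K klE0 0 ω k *
                  (if c = 0 then torusChar (fun _ : Fin 1 => ((k.1 : ℕ) : ZMod (2 * (2 * M)))) dw.1 * torusChar k.2 dw.2
                    else conj (torusChar (fun _ : Fin 1 => ((k.1 : ℕ) : ZMod (2 * (2 * M)))) dw.1 * torusChar k.2 dw.2))‖ ≤
          C_T * (M / β))
    {X : ℝ} (hX0 : 0 ≤ X) (G : GeoConsts) (hGE : 16 * Real.exp 1 ^ 9 * (2 * klIsoT + C_T + X) ^ 4 ≤ G.cE4)
    (P : SplitConsts) (R : RenConsts) (c : ℝ) (hP : P.WF) (hR : R.WF2) (hc : 0 < c) (hc₃ : c ≤ klEngC₃3 P R)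
    (μ : ℝ) (hμ : μ ∈ klWindowC) (U : ℝ) (hU : 0 < U) (hU₀ : U ≤ klEngU₀3 P R c) (β : ℝ) (hβ : klBetaMin ≤ β)
    (hβc : β ≤ Real.exp (c / U ^ 2)) (K : TrigPolyC4v) (hK : FrameOK R U (nScales β) μ K) (L M : ℕ) [NeZero L] [NeZero M]
    (hL : klEngL₃ β U ≤ L) (hM : klEngM₃ β U L ≤ M)
    {B : ℝ} (hB1 : 1 ≤ B) (hB : ∀ i ≤ 5, ∀ t, ‖iteratedDeriv i salmhoferCutoff t‖ ≤ B)
    {Abar : ℝ}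
    (hAbar : klScaleZeroA0 + uvTimeMomentConst klE0 7 32 +
        2 * (uvSpaceMomentConst klE0 1 (uvPieceSq klE0 (uvBaseQ B klE0 4) (uvBaseQ' B klE0 4)) +
          (1 / 4 * Real.sqrt (216 * (1 / klE0 + 1 / 2)) *
              ∑ e : Fin 2 × Fin 2, (uvLinV klE0 (1 + (e.1 : ℕ) + (e.2 : ℕ)) *
                  (B * ((1 + ((e.1 : ℕ) + (e.2 : ℕ)) + 2).factorial : ℝ) * (4 / klE0) ^ (1 + ((e.1 : ℕ) + (e.2 : ℕ)) + 1)) +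
                uvLinD klE0 (1 + (e.1 : ℕ) + (e.2 : ℕ)) *
                  (B * ((1 + ((e.1 : ℕ) + (e.2 : ℕ)) + 3).factorial : ℝ) * (4 / klE0) ^ (1 + ((e.1 : ℕ) + (e.2 : ℕ)) + 2)))) *
            (4608 * (1 + R.Gfr 0 + R.Gfr 1 + R.Gfr 2 + R.Gfr 3) ^ 4 * ((((nScales β : ℕ) : ℝ) + 1) * U ^ 2 + 2 * |U|))) ≤ Abar)
    {kKbar : ℝ}
    (hkKbar : klKappaFrameC R * |U| + 2 * ((((nScales β : ℕ) : ℝ) + 1) * U ^ 2 *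
        (6 * (Real.pi * R.Gfr 1 / 2 + Real.pi ^ 2 * R.Gfr 2 / (2 * Real.sqrt 2) + Real.pi ^ 3 * R.Gfr 3 / 8))) ≤ kKbar)
    (hθ1 : 16 * Real.exp 1 ^ 5 * Abar * kKbar ≤ 1) (hθ2 : 64 * Real.exp 1 ^ 9 * Real.sqrt (2 * (7 + 6047)) ^ 2 * Abar * |U| ≤ 1)
    (hTX : ∀ (ω : Fin (sectorCount 0)) (c' : Fin 2), 1 / (|β| * (L : ℝ) ^ 2) *
        ∑ dw : TorusSite 1 (2 * (2 * M)) × TorusSite 2 L, (torusSiteDist dw.2 0 : ℝ) *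
            ‖∑ k : FreqMomentum L M, klAnisoFamily L M β μ K klE0 0 ω k *
              (if c' = 0 then torusChar (fun _ : Fin 1 => ((k.1 : ℕ) : ZMod (2 * (2 * M)))) dw.1 * torusChar k.2 dw.2
                else conj (torusChar (fun _ : Fin 1 => ((k.1 : ℕ) : ZMod (2 * (2 * M)))) dw.1 * torusChar k.2 dw.2))‖ ≤ X * (M / β)) :
    EngineFirstMoments L M G P (klEngQ5 P R) β U μ K 0 := by
  classical
  haveI : NeZero (2 * (2 * M)) := ⟨by have := NeZero.ne M; omega⟩
  -- regime sizes
  have hRwf : R.WF := hR.wf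
  have hGfr : ∀ j, 0 ≤ R.Gfr j := hRwf.2.2
  have hβ0 : 0 < β := beta_pos_of_klBetaMin_le hβ
  have hβ128 : (128 : ℝ) ≤ β := by simpa [klBetaMin] using hβ
  obtain ⟨hL15, hβL, hM2, hβM, hβ3M, hMβ3⟩ := scaleZero_regime_sizes hβ hL hM
  have hMpos : (0 : ℝ) < M := by linarith only [hβ128, hβM]
  have hLpos : (0 : ℝ) < L := by linarith only [hβ128, hβL]
  have hU1 : |U| ≤ 1 := abs_le_one_of_le_klEngU₀3 hU hU₀
  have hUabs : |U| = U := abs_of_pos hU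
  have hκU : 16 / 15 * (R.Gfr 0 * |U|) ≤ 1 / 50 := gfr0_abs_mul_le_of_le_klEngU₀3 hU hU₀
  have hMβ13 : klE0 * β ≤ Real.pi * (2 * M - 13) := by
    have hE : klE0 = 1 / 32 := by norm_num [klE0]
    rw [hE]
    have hβ3 : (128 : ℝ) ^ 2 * β ≤ β ^ 3 := by
      have h1 : 0 ≤ β * (β - 128) * (β + 128) := by
        have := sub_nonneg.2 hβ128
        positivity
      nlinarith only [h1]
    have h2 : β ≤ 2 * (M : ℝ) - 13 := by linarith only [hβ3, hβ3M, hβ128]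
    have h3 : (1 : ℝ) / 32 * β ≤ 3 * (2 * (M : ℝ) - 13) := by linarith only [h2, hβ128]
    have h4 : 3 * (2 * (M : ℝ) - 13) ≤ Real.pi * (2 * M - 13) :=
      mul_le_mul_of_nonneg_right Real.pi_gt_three.le (by linarith only [h2, hβ128])
    exact h3.trans h4
  have hN4 : (((2 * (2 * M) : ℕ) : ℝ)) = 4 * M := by push_cast; ring
  have hN0 : 0 < (((2 * (2 * M) : ℕ) : ℝ)) := by rw [hN4]; positivity
  have hMN : 2 * M ≤ 2 * (2 * M) := by omega
  have hκ0 : 0 < Real.sqrt (2 * (7 + 6047)) := Real.sqrt_pos.2 (by norm_num)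
  have hA0pos : 0 < klScaleZeroA0 := klScaleZeroA0_pos
  -- the Gram constant
  have hGB := isGramBoundedR_scaleZero_of_frameOK_sharp (L := L) (M := M) hK hβ hβL
  -- the weighted covariance torus sum `A_w ≤ 4M·Ā/β`
  have hAXnn : 0 ≤ uvTimeMomentConst klE0 7 32 := by
    have := timeMoment_scaleZero_of_frameOK (L := L) hK hβ hβ3M hMN 0
    refine le_trans ?_ this
    exact mul_nonneg (div_nonneg hβ0.le (Nat.cast_nonneg _)) (Finset.sum_nonneg fun a _ => Finset.sum_nonneg fun bv _ =>
      mul_nonneg (mul_nonneg (div_nonneg hβ0.le (Nat.cast_nonneg _)) (abs_nonneg _)) (norm_nonneg _))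
  have hAbar0 : 0 < Abar := by
    refine lt_of_lt_of_le ?_ hAbar
    have hsp := spaceMoment_scaleZero_of_frameOK (L := L) (M := M) (N := 2 * (2 * M)) hK hRwf hU1 hβ hβ3M hMN hB1 hB
      (l := 0) (l' := 1) (by decide) 0
    have hsp0 : 0 ≤ β / (((2 * (2 * M) : ℕ) : ℝ)) * ∑ a : TorusSite 1 (2 * (2 * M)), ∑ bv : TorusSite 2 L,
        |(((bv 0).valMinAbs : ℤ) : ℝ)| * ‖∑ q₀ : TorusSite 1 (2 * (2 * M)), ∑ qv : TorusSite 2 L, torusChar q₀ a * torusChar qv bv *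
          gridSymbol L M (2 * (2 * M)) β (uvSymbolCT L M β μ K klE0) 0 q₀ qv‖ :=
      mul_nonneg (div_nonneg hβ0.le (Nat.cast_nonneg _)) (Finset.sum_nonneg fun a _ => Finset.sum_nonneg fun bv _ =>
        mul_nonneg (abs_nonneg _) (norm_nonneg _))
    have hAT := hAXnn
    linarith only [hsp0.trans hsp, hAT, hA0pos]
  have hAw : 0 < 4 * M * Abar / β := by positivity
  have hA : ∀ σ : Fin 2, ∑ a : TorusSite 1 (2 * (2 * M)), ∑ bv : TorusSite 2 L,
      (1 + (β / (2 * (2 * M) : ℕ) * cyclicDist (2 * (2 * M)) (a 0) 0 + torusSiteDist bv 0)) *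
        ‖∑ q₀ : TorusSite 1 (2 * (2 * M)), ∑ qv : TorusSite 2 L, torusChar q₀ a * torusChar qv bv *
          gridSymbol L M (2 * (2 * M)) β (uvSymbolCT L M β μ K klE0) σ q₀ qv‖ ≤ 4 * M * Abar / β := by
    intro σ
    have h := weightedSum_le_of_parts (L := L) (N := 2 * (2 * M)) hβ0
      (fun a bv => ‖∑ q₀ : TorusSite 1 (2 * (2 * M)), ∑ qv : TorusSite 2 L, torusChar q₀ a * torusChar qv bv *
          gridSymbol L M (2 * (2 * M)) β (uvSymbolCT L M β μ K klE0) σ q₀ qv‖) (fun _ _ => norm_nonneg _)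
      (plainTorusSum_scaleZero_le_A0 (L := L) hK hβ hβ3M σ) (timeMoment_scaleZero_of_frameOK (L := L) hK hβ hβ3M hMN σ)
      (fun l => by
        fin_cases l
        · exact spaceMoment_scaleZero_of_frameOK (L := L) (M := M) (N := 2 * (2 * M)) hK hRwf hU1 hβ hβ3M hMN hB1 hB
            (l := 0) (l' := 1) (by decide) σ
        · exact spaceMoment_scaleZero_of_frameOK (L := L) (M := M) (N := 2 * (2 * M)) hK hRwf hU1 hβ hβ3M hMN hB1 hB
            (l := 1) (l' := 0) (by decide) σ)
    refine h.trans ?_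
    rw [hN4]
    have : (4 : ℝ) * M / β * _ ≤ 4 * M / β * Abar := mul_le_mul_of_nonneg_left hAbar (by positivity)
    calc _ ≤ 4 * M / β * Abar := this
      _ = 4 * M * Abar / β := by ring
  -- the frame's weighted size and θ_w ≤ 1/2
  have hkK : ∑ z : TorusSite 2 L, ‖framePosKernel L K z‖ * (1 + torusSiteDist z 0) ≤ kKbar :=
    (frameKernel_weightedL1_le (L := L) hRwf hU.ne' hU1 hK).trans hkKbar
  have hθ := thetaW_scaleZero_le_half (L := L) (M := M) hβ0 K hAbar0.le hkK hθ1 hθ2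
  -- the weighted multiplier torus sum `T_w ≤ (M/β)(2 klIsoT + C_T + X)`
  obtain ⟨T₀, hT₀0, hT₀⟩ := TorusFourierL2.exists_isoTorusBoundAt
  have hIso := isoTorusBoundAt_klIsoT hT₀0 hT₀
  have hTw0 : 0 ≤ M / β * (2 * klIsoT + C_T + X) := by
    have := klIsoT_nonneg
    positivity
  have hT : ∀ (ω : Fin (sectorCount 0)) (c' : Fin 2), 1 / (|β| * (L : ℝ) ^ 2) *
      ∑ dw : TorusSite 1 (2 * (2 * M)) × TorusSite 2 L,
        (1 + (β / (2 * (2 * M) : ℕ) * cyclicDist (2 * (2 * M)) (dw.1 0) 0 + torusSiteDist dw.2 0)) *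
          ‖∑ k : FreqMomentum L M, klAnisoFamily L M β μ K klE0 0 ω k *
            (if c' = 0 then torusChar (fun _ : Fin 1 => ((k.1 : ℕ) : ZMod (2 * (2 * M)))) dw.1 * torusChar k.2 dw.2
              else conj (torusChar (fun _ : Fin 1 => ((k.1 : ℕ) : ZMod (2 * (2 * M)))) dw.1 * torusChar k.2 dw.2))‖ ≤
      M / β * (2 * klIsoT + C_T + X) := by
    intro ω c'
    set g : TorusSite 1 (2 * (2 * M)) × TorusSite 2 L → ℝ := fun dw =>
      ‖∑ k : FreqMomentum L M, klAnisoFamily L M β μ K klE0 0 ω k *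
        (if c' = 0 then torusChar (fun _ : Fin 1 => ((k.1 : ℕ) : ZMod (2 * (2 * M)))) dw.1 * torusChar k.2 dw.2
          else conj (torusChar (fun _ : Fin 1 => ((k.1 : ℕ) : ZMod (2 * (2 * M)))) dw.1 * torusChar k.2 dw.2))‖ with hg
    have hg0 : ∀ dw, 0 ≤ g dw := fun dw => norm_nonneg _
    have hpre : 0 ≤ 1 / (|β| * (L : ℝ) ^ 2) := by positivity
    -- plain part: the isotropic torus bound at `m = 0` (`klAnisoFamily … 0 = klIsoFamily … 0`)
    have hplain : 1 / (|β| * (L : ℝ) ^ 2) * ∑ dw : TorusSite 1 (2 * (2 * M)) × TorusSite 2 L, g dw ≤ klIsoT * (2 * M / β) := by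
      have h := hIso P R c hP hR hc hc₃ μ hμ U hU hU₀ β hβ hβc K hK L M hL hM 0 ω c'
      have hw : klIsoT / imagTimeWeight β M = klIsoT * (2 * M / β) := by
        rw [imagTimeWeight]; field_simp
      rw [hw] at h
      exact h
    have htime : 1 / (|β| * (L : ℝ) ^ 2) * ∑ dw : TorusSite 1 (2 * (2 * M)) × TorusSite 2 L,
        (β / (2 * (2 * M) : ℕ) * cyclicDist (2 * (2 * M)) (dw.1 0) 0) * g dw ≤ C_T * (M / β) :=
      hCT L M R U (nScales β) μ K hK hGfr hμ hκU hL15 β hβ hβM hMβ13 ω c'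
    have hspace : 1 / (|β| * (L : ℝ) ^ 2) * ∑ dw : TorusSite 1 (2 * (2 * M)) × TorusSite 2 L,
        (torusSiteDist dw.2 0 : ℝ) * g dw ≤ X * (M / β) := hTX ω c'
    have hsplit : ∑ dw : TorusSite 1 (2 * (2 * M)) × TorusSite 2 L,
        (1 + (β / (2 * (2 * M) : ℕ) * cyclicDist (2 * (2 * M)) (dw.1 0) 0 + torusSiteDist dw.2 0)) * g dw =
        ∑ dw : TorusSite 1 (2 * (2 * M)) × TorusSite 2 L, g dw +
          ∑ dw : TorusSite 1 (2 * (2 * M)) × TorusSite 2 L, (β / (2 * (2 * M) : ℕ) * cyclicDist (2 * (2 * M)) (dw.1 0) 0) * g dw +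
          ∑ dw : TorusSite 1 (2 * (2 * M)) × TorusSite 2 L, (torusSiteDist dw.2 0 : ℝ) * g dw := by
      rw [← Finset.sum_add_distrib, ← Finset.sum_add_distrib]
      exact Finset.sum_congr rfl fun dw _ => by ring
    rw [hsplit, mul_add, mul_add]
    have : klIsoT * (2 * M / β) + C_T * (M / β) + X * (M / β) = M / β * (2 * klIsoT + C_T + X) := by ring
    linarith only [hplain, htime, hspace, this]
  -- the reduction
  intro Ω i k
  refine (firstMoment_zero_le_of_torusSums (L := L) (M := M) hβ0 U μ K hκ0 hGB hAw hA hκ0 (lt_of_le_of_lt hθ (by norm_num))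
    hTw0 hT Ω i k).trans ?_
  -- bookkeeping of the right-hand side: `ε³·T_w(2T_w)³·κ₀⁻⁴e(2e²κ₀)⁴|U|β/N/(1-θ_w)² ≤ 16e⁹(2klIsoT + C_T + X)⁴·|U| ≤ G.cE4·|U|`
  have hsc : ((sectorCount 0 : ℕ) : ℝ) = 2 := by norm_num [sectorCount]
  have hQ : 0 ≤ (klEngQ5 P R).cE4 := (klEngQ5_wf P R).2.2.2.1
  have hKlam : 1 ≤ P.Klam := hP.1
  have ht0 : 0 ≤ 2 * klIsoT + C_T + X := by have := klIsoT_nonneg; positivity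
  set t := 2 * klIsoT + C_T + X with ht
  set θv := Real.exp 1 * (4 * M * Abar / β) *
        normV (GridLeg (GridPoint L (2 * (2 * M)))) (Real.sqrt (2 * (7 + 6047))) (Real.sqrt (2 * (7 + 6047)))
          ((fun m' : ℕ => if m' = 1 then |β| / (2 * (2 * M) : ℕ) * ∑ z : TorusSite 2 L, ‖framePosKernel L K z‖ * (1 + torusSiteDist z 0)
            else if m' = 2 then |U| * |β| / (2 * (2 * M) : ℕ) else 0)) /
        Real.sqrt (2 * (7 + 6047)) ^ 2 with hθv
  have hden : 1 / 4 ≤ (1 - θv) ^ 2 := by nlinarith only [hθ]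
  have hden0 : 0 < (1 - θv) ^ 2 := by linarith only [hden]
  set q := (Real.sqrt (2 * (7 + 6047)))⁻¹ ^ (2 * 2) *
      (Real.exp 1 * ((Real.exp 2 * (Real.sqrt (2 * (7 + 6047)) + Real.sqrt (2 * (7 + 6047)))) ^ (2 * 2) *
        (|U| * |β| / (2 * (2 * M) : ℕ)))) with hq
  have hq0 : 0 ≤ q := by positivity
  rw [hsc, show (2 : ℕ) - 2 = 0 from rfl, pow_zero, mul_one]
  have hstep : q / (1 - θv) ^ 2 ≤ q * 4 := by
    rw [div_le_iff₀ hden0]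
    nlinarith only [hden, hq0]
  have hε0 : 0 ≤ imagTimeWeight β M := by unfold imagTimeWeight; positivity
  have hTwnn : 0 ≤ M / β * t := by positivity
  have hmono : imagTimeWeight β M ^ 3 * (M / β * t * (2 * (M / β * t)) ^ (2 * 2 - 1) * (q / (1 - θv) ^ 2)) ≤
      imagTimeWeight β M ^ 3 * (M / β * t * (2 * (M / β * t)) ^ (2 * 2 - 1) * (q * 4)) := by
    have h1 : 0 ≤ M / β * t * (2 * (M / β * t)) ^ (2 * 2 - 1) := by positivity
    exact mul_le_mul_of_nonneg_left (mul_le_mul_of_nonneg_left hstep h1) (pow_nonneg hε0 3)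
  have hident : imagTimeWeight β M ^ 3 * (M / β * t * (2 * (M / β * t)) ^ (2 * 2 - 1) * (q * 4)) =
      16 * Real.exp 1 ^ 9 * t ^ 4 * |U| := by
    have he2 : Real.exp 2 = Real.exp 1 ^ 2 := by rw [← Real.exp_nat_mul]; norm_num
    rw [hq, imagTimeWeight, hN4, abs_of_pos hβ0, he2, show (2 : ℕ) * 2 - 1 = 3 from rfl, show (2 : ℕ) * 2 = 4 from rfl]
    generalize Real.sqrt (2 * (7 + 6047)) = κ at hκ0 ⊢
    have hκne : κ ≠ 0 := hκ0.ne'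
    field_simp
    ring
  refine hmono.trans ?_
  rw [hident, pow_zero, mul_one]
  have hG0 : 0 ≤ G.cE4 := le_trans (by positivity) hGE
  have hU0 : 0 ≤ |U| := abs_nonneg U
  have h1 : 16 * Real.exp 1 ^ 9 * t ^ 4 * |U| ≤ G.cE4 * |U| := mul_le_mul_of_nonneg_right hGE hU0
  have h2 : G.cE4 ≤ (G.cE4 + (klEngQ5 P R).cE4 * |U|) * P.Klam := by
    have h3 : 0 ≤ (klEngQ5 P R).cE4 * |U| := mul_nonneg hQ hU0
    nlinarith only [hG0, h3, hKlam]
  exact h1.trans (mul_le_mul_of_nonneg_right h2 hU0)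

end Main

end Summit.HubbardSuperconductivity.HubbardSuperconductivity.Theorems.EngineV8

end
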